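import Summits.QuantumFields.YangMills.Theorems.BalabanUVNodesN07ExistenceFromProp8
import Literature.MathematicalPhysics.QuantumFieldTheory.Balaban1983to89.B12CriticalPoint23

/-!
# BalabanUVNodes ∕ N07 ([Balaban1985Variational] Theorem 1 (8) p. 279) — NON-VACUITY OF THE DISPLAYED SENTENCE «BOUNDARY AVOIDANCE»: at every
# FLAT datum (the averages `Ū₁^k` of a configuration `U₁` of zero Wilson action — in particular of `U₁ ≡ 1`) EVERY minimiser of (5) over EVERY
# closed class `closure 𝔘_k(e) ∩ 𝔅_k(Ū₁^k)`, `e > 0`, is flat and lies in the open class `𝔘_k(e)`; flat configurations lie in [B11] (2)'s space;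
# and DOWNWARD PROPAGATION — avoidance at one radius `ε₀` (with Prop. 8 there) gives avoidance at every radius `e ∈ [B₃ε₁, ε₀]`

Track A of `YM-PLAN.md` (cell `pub-ymgap`, HUMAN RULING D-0062), DAG node **N07**; seat `pub-ymgap-dag-n07-e` (generation 5; module 14, companion of
`…N07DirectMethodInduction` ∕ `…N07ExistenceFromProp8` (p488364 ∕ p489763), whose displayed non-printed sentence it tests; `--supports
stmt-QuantumFields-19903 --as helper`).  THEOREMS ONLY (0 `def`, 0 `sorry`); nothing imported is modified.  Source: [Balaban1985Variational]
T. Bałaban, Commun. Math. Phys. **102** (1985) 277–309, (2), (5) p. 278, Thm 1 (8) p. 279; [Balaban1985RegularSpaces] (1.1)–(1.2) p. 76 for the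
current clause of (2).

WHY.  Modules 11b∕12 re-point Theorem 1's existence clause (8) ∕ Proposition 7's existence sentence onto ONE displayed non-printed ∀-sentence, BOUNDARY
AVOIDANCE at a datum `V`: «every minimiser of the Wilson action over `closure 𝔘_k(e) ∩ 𝔅_k(V)` lies in the open class `𝔘_k(e)`».  The cell's reader rules ask of
every displayed hypothesis that it be SATISFIABLE at the objects of record (cf. ref-G (w6) on Sect. F's cube class).  This module proves it HOLDS at all
flat data: if the fibre of `V` contains a configuration of zero action then every closed-class minimiser has zero action (the action is non-negative),
hence every plaquette variable equal to `1` (r09's `B12CriticalPoint23.eq_one_of_reTr_eq_one_specialUnitaryGroup`: on `SU(N)`, `Re tr g = 1 ⇒ g = 1`),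
hence lies in `𝔘_k(e)` for EVERY `e > 0` — both clauses of (2): the plaquette letters vanish and so does the covariant divergence `D*_U ∂U` of
[Balaban1985RegularSpaces] (1.2) (its plaquette fields are `≡ 1`, and `R(U)1 − 1 = 0`).

CONTENT.  §1 `holT_plaqWord_eq_one_of_flat`, `plaqFT_eq_one_of_flat`, `covDivT_eq_zero_of_flat`, ★ `inUkClassB11_of_flat` (a configuration all of
whose plaquette variables are `1` lies in `𝔘_k(e)` for every `e > 0`, every `k`), `plaqHol_eq_one_of_wilsonAction4_eq_zero` (zero action ⇒ flat;
twin of dag-n12-e's `B15Claim189PinNonVacuity` lemma, re-derived to keep the import cone), `inUkClassB11_of_wilsonAction4_eq_zero`.  §2 ★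
`avoidance_at_flat_datum` (the displayed ∀-sentence HOLDS at `V = Ū₁^k` whenever `A(U₁) = 0`, for every radius `e > 0` and every closed class between),
`wilsonAction4_eq_zero_of_isBackground_closure_flat`, `exists_interior_closureMinimiser_at_flat_datum` (the ∃-form: `U₁` itself is an interior
closed-class minimiser), and the instance `U₁ ≡ 1` (`avoidance_at_unit_datum`; its datum `Ū^k(1)` is the unit configuration by n12-e's
`B15Claim189UnitTestAtRecord.iter_avOfRecord_one`, not imported here).  §3 ★ DOWNWARD PROPAGATION: avoidance at ONE radius `ε₀` together with
Prop. 8's object sentence at `ε₀` (and the direct method's `ε₀`-minimiser) gives avoidance at EVERY radius `e ∈ [B₃ε₁, ε₀]`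
(`avoidance_of_avoidanceAt_of_prop8At`, `avoidanceAt_mono_of_prop8At`, `…_directMethod`) — the displayed sentence of modules 11b∕12 may be assumed at
print's single radius of Proposition 8.

HONEST FRAMING.  A consistency check of a displayed hypothesis at the trivial (flat) data — it says NOTHING about non-flat data, where boundary avoidance
is the located existence-side residue of D-B11-2 (an L^∞ a-priori property of minimisers); nothing of [Balaban1985Variational] asserted; N07 NOT discharged;
COUNT-NEUTRAL (5∕27 unmoved); one finite four-torus programme at fixed `ε = L^{−K}` — NOT the continuum limit, NOT ℝ⁴, NOT infinite volume, NOT OS, NOT a mass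
gap, NOT Clay.  No `instance`, no notation, 0 kit.
-/

noncomputable section

namespace Summit.QuantumFields.YangMills.BalabanUVNodes.N07AvoidanceAtFlatData

open Set Filter Topology
open Literature.MathematicalPhysics.QuantumFieldTheory.Balaban1983to89
open Literature.MathematicalPhysics.QuantumFieldTheory.Balaban1983to89.T4Continuum (T4Family)
open Literature.MathematicalPhysics.QuantumFieldTheory.Balaban1983to89.Node00
open Literature.MathematicalPhysics.QuantumFieldTheory.Balaban1983to89.B10Eq27TorusAxialLog (holT toUField unitsField holT_plaqWord)
open Literature.MathematicalPhysics.QuantumFieldTheory.Balaban1983to89.B10Eq68TorusRegularity (plaqFT covDivT covDerivT RegPlaqAt RegDivAt)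
open Literature.MathematicalPhysics.QuantumFieldTheory.Balaban1983to89.B7Eq78Linearization (conjR conjR_apply)
open Literature.MathematicalPhysics.QuantumFieldTheory.Balaban1983to89.B11Thm1CarrierT (isBackground_of_subset_of_mem)
open scoped Matrix.Norms.L2Operator

variable {F : T4Family} {N : ℕ} [NeZero N]

/-! ## §1 Flat configurations lie in [B11] (2)'s space `𝔘_k(e)` for every `e > 0` -/

section Flat

variable {P : Params} {j : ℕ}

/-- **Every plaquette word transports to `1` on a flat configuration** (all three orientations: `κ < μ` is the plaquette variable, `κ = μ` is a
backtracking word, `κ > μ` is the inverse plaquette). [cite: Balaban1985Averaging, (9) p.19] -/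
theorem holT_plaqWord_eq_one_of_flat {U : GaugeField P j (SU N)} (hflat : ∀ p : Plaq P j, GaugeField.plaqHol U p = 1) (x : Site P j)
    (κ μ : Fin P.d) : holT U x (B7Prop1Explicit.plaqWord κ μ) = 1 := by
  rw [holT_plaqWord]
  rcases lt_trichotomy κ μ with h | rfl | h
  · exact hflat ⟨x, κ, μ, h⟩
  · group
  · have h1 : U ⟨x, μ⟩ * U ⟨x.shift μ, κ⟩ * (U ⟨x.shift κ, μ⟩)⁻¹ * (U ⟨x, κ⟩)⁻¹ = 1 := hflat ⟨x, μ, κ, h⟩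
    calc U ⟨x, κ⟩ * U ⟨x.shift κ, μ⟩ * (U ⟨x.shift μ, κ⟩)⁻¹ * (U ⟨x, μ⟩)⁻¹
        = (U ⟨x, μ⟩ * U ⟨x.shift μ, κ⟩ * (U ⟨x.shift κ, μ⟩)⁻¹ * (U ⟨x, κ⟩)⁻¹)⁻¹ := by group
      _ = 1 := by rw [h1, inv_one]

omit [NeZero N] in
/-- **The plaquette fields (the letters `F_{κμ}` of [Balaban1985RegularSpaces] (1.1)–(1.2)) of a flat configuration are `≡ 1`** in `M_N(ℂ)`.
[cite: Balaban1985RegularSpaces, (1.1) p.76; Balaban1985Variational, (2) p.278] -/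
theorem plaqFT_eq_one_of_flat [NeZero N] {U : GaugeField P j (SU N)} (hflat : ∀ p : Plaq P j, GaugeField.plaqHol U p = 1) (κ μ : Fin P.d) :
    plaqFT (unitsField (toUField U)) κ μ = fun _ => 1 := by
  funext x
  rw [plaqFT_unitsField_toUField, holT_plaqWord_eq_one_of_flat hflat x κ μ]
  rfl

/-- **The covariant divergence `(D*_U ∂U)(b)` of a flat configuration vanishes at every bond** (`F ≡ 1`, `R(U)1 − 1 = U·1·U⁻¹ − 1 = 0`).
[cite: Balaban1985RegularSpaces, (1.2) p.76; Balaban1985Variational, (2) p.278] -/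
theorem covDivT_eq_zero_of_flat {U : GaugeField P j (SU N)} (hflat : ∀ p : Plaq P j, GaugeField.plaqHol U p = 1) (η : ℝ) (μ : Fin P.d)
    (x : Site P j) : covDivT η (unitsField (toUField U)) μ x = 0 := by
  unfold covDivT covDerivT
  simp only [plaqFT_eq_one_of_flat hflat, conjR_apply, mul_one, Units.mul_inv, sub_self, smul_zero, Finset.sum_const_zero]

/-- ★ **A FLAT CONFIGURATION LIES IN [B11] (2)'s SPACE `𝔘_k(e)` FOR EVERY `e > 0`** (`Ω_j = T`, every `k`): both clauses of (2) — the plaquette letters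
`|U(∂p) − 1|` are `0 < eL^{−2j}` and the current letters `|(D*_U∂U)(b)|` are `0 < eL^{−2j}(L^jη)^{−1}`. [cite: Balaban1985Variational, (2) p.278] -/
theorem inUkClassB11_of_flat {K k : ℕ} {e : ℝ} (he : 0 < e) {U : GaugeField (F.P K) 0 (SU N)}
    (hflat : ∀ p : Plaq (F.P K) 0, GaugeField.plaqHol U p = 1) : InUkClassB11 F N K k e U := by
  intro j _
  have hL : (0 : ℝ) < ((F.P K).L : ℝ) ^ j := pow_pos (Nat.cast_pos.mpr (F.P K).L_pos) j
  have hη : (0 : ℝ) < (F.P K).eta k := pow_pos (inv_pos.mpr (Nat.cast_pos.mpr (F.P K).L_pos)) k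
  refine ⟨fun q _ => ?_, fun b _ => ?_⟩
  · rw [plaqFT_eq_one_of_flat hflat, sub_self, norm_zero]
    positivity
  · rw [covDivT_eq_zero_of_flat hflat, norm_zero]
    positivity

/-- **ON `SU(N)`, ZERO WILSON ACTION FORCES EVERY PLAQUETTE VARIABLE TO BE `1`** (the action is the sum of the non-negative terms `1 − Re tr U(∂p)`, and
`Re tr g = 1` only at `g = 1` — r09's `B12CriticalPoint23.eq_one_of_reTr_eq_one_specialUnitaryGroup`; twin of dag-n12-e's
`B15Claim189PinNonVacuity.plaqHol_eq_one_of_wilsonAction4_eq_zero`, re-derived here to keep the import cone). [cite: Balaban1987RG1, (0.2) p.252] -/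
theorem plaqHol_eq_one_of_wilsonAction4_eq_zero {U : GaugeField P j (SU N)} (hA : wilsonAction4 U = 0) (p : Plaq P j) :
    GaugeField.plaqHol U p = 1 := by
  unfold wilsonAction4 wilsonAction at hA
  have hnn : ∀ q ∈ (Finset.univ : Finset (Plaq P j)), 0 ≤ 1 * (1 - reTr (GaugeField.plaqHol U q)) := fun q _ => by
    have := GaugeGroup.reTr_le_one (GaugeField.plaqHol U q)
    rw [one_mul]; linarith
  have hp := (Finset.sum_eq_zero_iff_of_nonneg hnn).1 hA p (Finset.mem_univ p)
  rw [one_mul, sub_eq_zero] at hp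
  exact B12CriticalPoint23.eq_one_of_reTr_eq_one_specialUnitaryGroup _ hp.symm

/-- **A configuration of zero Wilson action lies in `𝔘_k(e)` for every `e > 0`.** [cite: Balaban1985Variational, (2), (5) p.278] -/
theorem inUkClassB11_of_wilsonAction4_eq_zero {K k : ℕ} {e : ℝ} (he : 0 < e) {U : GaugeField (F.P K) 0 (SU N)} (hA : wilsonAction4 U = 0) :
    InUkClassB11 F N K k e U :=
  inUkClassB11_of_flat he (plaqHol_eq_one_of_wilsonAction4_eq_zero hA)

/-- The unit configuration has zero Wilson action. [cite: Balaban1987RG1, (0.2) p.252 (bookkeeping)] -/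
theorem wilsonAction4_one : wilsonAction4 (1 : GaugeField P j (SU N)) = 0 := by
  unfold wilsonAction4 wilsonAction
  simp [B15Chi124DetSets.plaqHol_one, GaugeGroup.reTr_one]

end Flat

/-! ## §2 Boundary avoidance HOLDS at every flat datum, for every radius -/

/-- **EVERY CLOSED-CLASS MINIMISER OVER THE FIBRE OF A FLAT DATUM HAS ZERO ACTION**: if `A(U₁) = 0` and `U₀` minimises (5) over `reg ∩ 𝔅_k(Ū₁^k)` for a class
`reg ∋ U₁`, then `A(U₀) = 0` (`0 ≤ A(U₀) ≤ A(U₁) = 0`). [cite: Balaban1985Variational, (5) p.278] -/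
theorem wilsonAction4_eq_zero_of_isBackground_flat {K k : ℕ} {reg : Set (GaugeField (F.P K) 0 (SU N))} {U₁ U₀ : GaugeField (F.P K) 0 (SU N)}
    (hA : wilsonAction4 U₁ = 0) (hU₁ : U₁ ∈ reg)
    (h : IsBackground (avOfRecord F N K) reg k (Averaging.iter (avOfRecord F N K) k U₁) U₀) : wilsonAction4 U₀ = 0 :=
  le_antisymm ((h.2.2 U₁ hU₁ rfl).trans_eq hA) (wilsonAction4_nonneg U₀)

/-- ★★ **BOUNDARY AVOIDANCE HOLDS AT EVERY FLAT DATUM, FOR EVERY RADIUS.**  Let `U₁` have zero Wilson action (a flat configuration — e.g. `U₁ ≡ 1`) and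
`V := Ū₁^k` (the averages of record of `U₁`).  Then for every `e > 0` and every class `reg` with `𝔘_k(e) ⊆ reg` (e.g. `reg = closure 𝔘_k(e)`), EVERY
minimiser of (5) over `reg ∩ 𝔅_k(V)` lies in the OPEN class `𝔘_k(e)`: the displayed ∀-sentence of modules 11b∕12 is TRUE at `V`.
[cite: Balaban1985Variational, Thm 1 (8) p.279, (2) p.278] -/
theorem avoidance_at_flat_datum {K k : ℕ} {e : ℝ} (he : 0 < e) {reg : Set (GaugeField (F.P K) 0 (SU N))}
    (hreg : {U | InUkClassB11 F N K k e U} ⊆ reg) {U₁ : GaugeField (F.P K) 0 (SU N)} (hA : wilsonAction4 U₁ = 0) :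
    ∀ U₀ : GaugeField (F.P K) 0 (SU N),
      IsBackground (avOfRecord F N K) reg k (Averaging.iter (avOfRecord F N K) k U₁) U₀ → InUkClassB11 F N K k e U₀ :=
  fun _ h => inUkClassB11_of_wilsonAction4_eq_zero he
    (wilsonAction4_eq_zero_of_isBackground_flat hA (hreg (inUkClassB11_of_wilsonAction4_eq_zero he hA)) h)

/-- The closed-class instance: at `V = Ū₁^k`, `A(U₁) = 0`, every minimiser over `closure 𝔘_k(e) ∩ 𝔅_k(V)` lies in `𝔘_k(e)` — the hypothesis `hav`∕`hint`
of `…N07DirectMethodInduction` ∕ `…N07ExistenceFromProp8` at this datum, any `e > 0`. [cite: Balaban1985Variational, Thm 1 (8) p.279] -/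
theorem avoidance_closure_at_flat_datum {K k : ℕ} {e : ℝ} (he : 0 < e) {U₁ : GaugeField (F.P K) 0 (SU N)} (hA : wilsonAction4 U₁ = 0) :
    ∀ U₀ : GaugeField (F.P K) 0 (SU N),
      IsBackground (avOfRecord F N K) (closure {U | InUkClassB11 F N K k e U}) k (Averaging.iter (avOfRecord F N K) k U₁) U₀ →
        InUkClassB11 F N K k e U₀ :=
  avoidance_at_flat_datum he subset_closure hA

/-- **The ∃-form too**: `U₁` itself is a minimiser of (5) over `closure 𝔘_k(e) ∩ 𝔅_k(Ū₁^k)` lying in the open class (zero action is minimal).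
[cite: Balaban1985Variational, Thm 1 (8) p.279] -/
theorem exists_interior_closureMinimiser_at_flat_datum {K k : ℕ} {e : ℝ} (he : 0 < e) {U₁ : GaugeField (F.P K) 0 (SU N)}
    (hA : wilsonAction4 U₁ = 0) :
    ∃ U₀ : GaugeField (F.P K) 0 (SU N),
      IsBackground (avOfRecord F N K) (closure {U | InUkClassB11 F N K k e U}) k (Averaging.iter (avOfRecord F N K) k U₁) U₀ ∧
        InUkClassB11 F N K k e U₀ :=
  ⟨U₁, ⟨rfl, subset_closure (inUkClassB11_of_wilsonAction4_eq_zero he hA),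
    fun U _ _ => hA.trans_le (wilsonAction4_nonneg U)⟩, inUkClassB11_of_wilsonAction4_eq_zero he hA⟩

/-- **A minimal orbit in `𝔘_k(e) ∩ 𝔅_k(Ū₁^k)` exists at every flat datum** — `U₁` (so at flat data the existence clause (8) holds for every `B₃ε₁ > 0`
with no displayed hypothesis at all). [cite: Balaban1985Variational, Thm 1 (8) p.279] -/
theorem isBackground_flat_self {K k : ℕ} {e : ℝ} (he : 0 < e) {U₁ : GaugeField (F.P K) 0 (SU N)} (hA : wilsonAction4 U₁ = 0) :
    IsBackground (avOfRecord F N K) {U | InUkClassB11 F N K k e U} k (Averaging.iter (avOfRecord F N K) k U₁) U₁ :=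
  ⟨rfl, inUkClassB11_of_wilsonAction4_eq_zero he hA, fun U _ _ => hA.trans_le (wilsonAction4_nonneg U)⟩

/-- **THE UNIT DATUM**: at `V = Ū^k(1)` (`= 1`, dag-n12-e's `B15Claim189UnitTestAtRecord.iter_avOfRecord_one`) boundary avoidance holds for every radius
`e > 0`. [cite: Balaban1985Variational, Thm 1 (8) p.279] -/
theorem avoidance_at_unit_datum {K k : ℕ} {e : ℝ} (he : 0 < e) :
    ∀ U₀ : GaugeField (F.P K) 0 (SU N),
      IsBackground (avOfRecord F N K) (closure {U | InUkClassB11 F N K k e U}) k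
          (Averaging.iter (avOfRecord F N K) k (1 : GaugeField (F.P K) 0 (SU N))) U₀ →
        InUkClassB11 F N K k e U₀ :=
  avoidance_closure_at_flat_datum he wilsonAction4_one

/-! ## §3 Downward propagation: avoidance at ONE radius `ε₀` (with Prop. 8 there) gives avoidance at every radius `e ∈ [B₃ε₁, ε₀]` -/

/-- ★ **BOUNDARY AVOIDANCE NEED ONLY BE DISPLAYED AT ONE RADIUS.**  Suppose at the datum `V`: (AV-ε₀) every minimiser of (5) over
`closure 𝔘_k(ε₀) ∩ 𝔅_k(V)` lies in `𝔘_k(ε₀)`; (P8-ε₀) Prop. 8's object sentence at `ε₀` («critical configurations of (5) on `𝔅_k(V)` in `𝔘_k(ε₀)` lie in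
`𝔘_k(B₃ε₁)`»); and a minimiser over `closure 𝔘_k(ε₀) ∩ 𝔅_k(V)` exists (the direct method).  Then for EVERY radius `e` with `B₃ε₁ ≤ e ≤ ε₀`, every
minimiser of (5) over `closure 𝔘_k(e) ∩ 𝔅_k(V)` lies in `𝔘_k(e)` (indeed in `𝔘_k(B₃ε₁)`).  Proof: the `ε₀`-minimiser is interior, hence critical
(p464601), hence in `𝔘_k(B₃ε₁) ⊆ 𝔘_k(e)` by (P8-ε₀); so the minimum values over the two closed classes agree, an `e`-minimiser is an `ε₀`-minimiser,
and the same chain applies to it. [cite: Balaban1985Variational, Thm 1 (8) p.279, Prop. 8 p.304] -/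
theorem avoidance_of_avoidanceAt_of_prop8At {K k : ℕ} {B₃ ε₁ e ε₀ : ℝ} (hB : B₃ * ε₁ ≤ e) (he : e ≤ ε₀) {V : GaugeField (F.P K) k (SU N)}
    (hP8 : ∀ U : GaugeField (F.P K) 0 (SU N), InUkClassB11 F N K k ε₀ U → Averaging.iter (avOfRecord F N K) k U = V →
      IsCritOfRecord F N K k V U → InUkClassB11 F N K k (B₃ * ε₁) U)
    (hav : ∀ U₀ : GaugeField (F.P K) 0 (SU N),
      IsBackground (avOfRecord F N K) (closure {U | InUkClassB11 F N K k ε₀ U}) k V U₀ → InUkClassB11 F N K k ε₀ U₀)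
    (hex : ∃ U₀ : GaugeField (F.P K) 0 (SU N), IsBackground (avOfRecord F N K) (closure {U | InUkClassB11 F N K k ε₀ U}) k V U₀) :
    ∀ U₁ : GaugeField (F.P K) 0 (SU N),
      IsBackground (avOfRecord F N K) (closure {U | InUkClassB11 F N K k e U}) k V U₁ → InUkClassB11 F N K k (B₃ * ε₁) U₁ := by
  -- the chain at radius `ε₀`: interior ⇒ minimiser over the open class ⇒ critical ⇒ in `𝔘_k(B₃ε₁)`
  have chain : ∀ U₀ : GaugeField (F.P K) 0 (SU N),
      IsBackground (avOfRecord F N K) (closure {U | InUkClassB11 F N K k ε₀ U}) k V U₀ → InUkClassB11 F N K k (B₃ * ε₁) U₀ := by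
    intro U₀ h₀
    have hopen : IsBackground (avOfRecord F N K) {U | InUkClassB11 F N K k ε₀ U} k V U₀ :=
      isBackground_of_subset_of_mem h₀ subset_closure (hav U₀ h₀)
    exact hP8 U₀ hopen.2.1 hopen.1 (isCritOfRecord_of_isBackground hopen)
  obtain ⟨U₀, h₀⟩ := hex
  have hU₀e : U₀ ∈ closure {U | InUkClassB11 F N K k e U} :=
    subset_closure (B11Thm1CarrierTLevelZero.inUkClassB11_mono hB (chain U₀ h₀))
  have hsub : closure {U : GaugeField (F.P K) 0 (SU N) | InUkClassB11 F N K k e U} ⊆ closure {U | InUkClassB11 F N K k ε₀ U} :=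
    closure_mono fun _ hU => B11Thm1CarrierTLevelZero.inUkClassB11_mono he hU
  intro U₁ h₁
  -- equal minimum values ⇒ `U₁` also minimises over the larger closed class
  have hle : wilsonAction4 U₁ ≤ wilsonAction4 U₀ := h₁.2.2 U₀ hU₀e h₀.1
  have h₁' : IsBackground (avOfRecord F N K) (closure {U | InUkClassB11 F N K k ε₀ U}) k V U₁ :=
    ⟨h₁.1, hsub h₁.2.1, fun U hU hUV => hle.trans (h₀.2.2 U hU hUV)⟩
  exact chain U₁ h₁'

/-- **… in particular avoidance at radius `e`** (`𝔘_k(B₃ε₁) ⊆ 𝔘_k(e)`). [cite: Balaban1985Variational, Thm 1 (8) p.279, Prop. 8 p.304] -/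
theorem avoidanceAt_mono_of_prop8At {K k : ℕ} {B₃ ε₁ e ε₀ : ℝ} (hB : B₃ * ε₁ ≤ e) (he : e ≤ ε₀) {V : GaugeField (F.P K) k (SU N)}
    (hP8 : ∀ U : GaugeField (F.P K) 0 (SU N), InUkClassB11 F N K k ε₀ U → Averaging.iter (avOfRecord F N K) k U = V →
      IsCritOfRecord F N K k V U → InUkClassB11 F N K k (B₃ * ε₁) U)
    (hav : ∀ U₀ : GaugeField (F.P K) 0 (SU N),
      IsBackground (avOfRecord F N K) (closure {U | InUkClassB11 F N K k ε₀ U}) k V U₀ → InUkClassB11 F N K k ε₀ U₀)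
    (hex : ∃ U₀ : GaugeField (F.P K) 0 (SU N), IsBackground (avOfRecord F N K) (closure {U | InUkClassB11 F N K k ε₀ U}) k V U₀) :
    ∀ U₁ : GaugeField (F.P K) 0 (SU N),
      IsBackground (avOfRecord F N K) (closure {U | InUkClassB11 F N K k e U}) k V U₁ → InUkClassB11 F N K k e U₁ :=
  fun U₁ h₁ => B11Thm1CarrierTLevelZero.inUkClassB11_mono hB (avoidance_of_avoidanceAt_of_prop8At hB he hP8 hav hex U₁ h₁)

/-- **The direct method supplies the `ε₀`-minimiser**: with a non-empty fibre `𝔘_k(ε₀) ∩ 𝔅_k(V)` and `ε₀ < α₀` (53)-admissible, (AV-ε₀) ∧ (P8-ε₀) give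
avoidance at every radius `e ∈ [B₃ε₁, ε₀]` — so the displayed sentence of modules 11b∕12 may be assumed at print's single radius of Proposition 8 only.
[cite: Balaban1985Variational, Thm 1 (8) p.279, Prop. 8 p.304] -/
theorem avoidanceAt_mono_of_prop8At_directMethod (K k : ℕ) {B₃ ε₁ e ε₀ α₀ : ℝ} (hB : B₃ * ε₁ ≤ e) (he : e ≤ ε₀) (hε₀ : ε₀ < α₀) (hα : 0 < α₀)
    (hα3 : (143 * (((((F.P K).d + 4 : ℕ) : ℝ)) ^ 2 / 4) ^ 2) * α₀ ≤ 1 / 3)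
    (hα2 : 2 * α₀ ≤ 2 * ExpMeanLog.deltaSU (Fin N) / ((((F.P K).d + 4) * (F.P K).L : ℕ) : ℝ) ^ 2)
    {V : GaugeField (F.P K) k (SU N)} (hne : ∃ U, InUkClassB11 F N K k ε₀ U ∧ Averaging.iter (avOfRecord F N K) k U = V)
    (hP8 : ∀ U : GaugeField (F.P K) 0 (SU N), InUkClassB11 F N K k ε₀ U → Averaging.iter (avOfRecord F N K) k U = V →
      IsCritOfRecord F N K k V U → InUkClassB11 F N K k (B₃ * ε₁) U)
    (hav : ∀ U₀ : GaugeField (F.P K) 0 (SU N),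
      IsBackground (avOfRecord F N K) (closure {U | InUkClassB11 F N K k ε₀ U}) k V U₀ → InUkClassB11 F N K k ε₀ U₀) :
    ∀ U₁ : GaugeField (F.P K) 0 (SU N),
      IsBackground (avOfRecord F N K) (closure {U | InUkClassB11 F N K k e U}) k V U₁ → InUkClassB11 F N K k e U₁ :=
  avoidanceAt_mono_of_prop8At hB he hP8 hav
    (N07DirectMethod.exists_isBackground_closure_inUkClassB11 K k hε₀ hα hα3 hα2 hne)

end Summit.QuantumFields.YangMills.BalabanUVNodes.N07AvoidanceAtFlatData

end
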